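import Mathlib.Geometry.Manifold.ContMDiffMap
import Mathlib.Topology.Homotopy.Basic
import Mathlib.Analysis.Calculus.FDeriv.Const
import Literature.NumberTheory.Transcendental.FormsAlgebra
import Literature.NumberTheory.Transcendental.FormIntegration
import Literature.NumberTheory.Transcendental.ComplexForms
import Literature.AlgebraicTopology.SingularHomology.SingularCochains
import Literature.AlgebraicTopology.SingularHomology.CupProduct
import Literature.AlgebraicTopology.SingularHomology.PoincareDuality
import HarnessLib

-- provenance: harness21/H21/H21/Prelude/TranscendKaehlerL/DeRhamTheorem.lean @ d0522d9 (interim HEAD d8f2665); M5 mechanical rewrite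
/-!
# de Rham's theorem: comparison of de Rham and singular cohomology

Trunk: TranscendKaehlerL (`H21/Outlines/TranscendKaehlerL.md`, item **C8 DeRhamTheorem** and its
addendum on complex coefficients), notion `de_rham_cohomology_manifold` (comparison part).

For a smooth (`C^∞`), Hausdorff, σ-compact manifold `M` modelled on a finite-dimensional model
with corners `I`, de Rham's theorem identifies the de Rham cohomology
`H^k_dR(M; ℝ) = Literature.deRhamCohomology I M ℝ k` (G21, `Literature.Prelude.Kaehler.ManifoldForms`) with the
singular cohomology `H^k(M; ℝ) = Literature.singularCohomology ℝ ℝ M k` (G04,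
`Literature.Prelude.AlgTop.SingularCochains`), naturally in `M`, multiplicatively (wedge/cup product of
C6 `Literature.Geometry.Kaehler.deRhamCohomology.cup` versus the Alexander–Whitney cup product `Literature.AlgebraicTopology.SingularHomology.cupProduct` of G04)
and sending the class of the constant function `1` to the unit `Literature.AlgebraicTopology.SingularHomology.singularCohomology.one`.

## Why a *family* and not `Nonempty (_ ≃ₗ[ℝ] _)`

A bare existence statement `Nonempty (H^k_dR(M) ≃ₗ[ℝ] H^k(M; ℝ))` for each `M` separately only
says that two real vector spaces have the same dimension; it is useless to consumers who must
transport a *specific* class (a Kähler class, a Chern class, a cup product) from one side to the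
other and compare the results on two manifolds related by a map. We therefore package the
de Rham isomorphisms of *all* manifolds modelled on a fixed `I` into one dependent function
`e : Literature.DeRhamIsoFamily I` and state naturality (`e.IsNatural`), multiplicativity
(`e.IsMultiplicative`) and the normalisation in degree `0` (`e.IsNormalized`) as predicates on
`e`; de Rham's theorem is `∃ e, e.IsNatural ∧ e.IsMultiplicative ∧ e.IsNormalized`
(`Literature.NumberTheory.Transcendental.exists_deRhamIsoFamily`). Downstream statements quantify over such an `e`
(`∀ e : DeRhamIsoFamily I, e.IsNatural → e.IsMultiplicative → …`).

## Universe discipline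

`singularCohomology ℝ ℝ M k` lives in `ModuleCat.{max u 0} ℝ` for `M : Type u`, and a family
indexed by all manifolds `M : Type u` modelled on `I : ModelWithCorners ℝ E H` lives in
`Type (u + 1)`; to quantify over `M` we need `E H M` in a *single* universe `u`. Hence in the
family sections `E H : Type u` and `M N : Type u`. The complex-coefficient family is stated in the
same polymorphic form (`E : Type u`); its consumers in `Statements/Hodge` use `u = 0`.

## Main definitions

* `Literature.MForm.const a`: the constant `0`-form with value `a`; `Literature.Geometry.Kaehler.deRhamCohomology.one`: the
  class `[1] ∈ H⁰_dR(M; A)`.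
* `Literature.DeRhamIsoFamily I`, `.IsNatural`, `.IsMultiplicative`, `.IsNormalized`.
* `Literature.Geometry.Kaehler.MForm.cpullbackₗ`, `Literature.NumberTheory.Transcendental.complexDeRhamCohomology.map`: the `ℂ`-linear pull-back on complex
  forms and on complex de Rham cohomology `H^k_dR(M; ℂ)` (C9, `ComplexForms`), needed to state
  naturality of the complex family.
* `Literature.ComplexDeRhamIsoFamily E`, `.IsNatural`.

## Main statements (named facts, D-0014: `Prop`-valued definitions with citations)

* `Literature.NumberTheory.Transcendental.exists_deRhamIsoFamily`: de Rham's theorem (de Rham 1931; Warner (1983), Thm. 5.36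
  (additive) and Thm. 5.45 (multiplicative); Bott–Tu (1982), §I.5 / Thm. 8.9, 15.8).
* `Literature.NumberTheory.Transcendental.exists_complexDeRhamIsoFamily`: the same with complex coefficients.
* `Literature.NumberTheory.Transcendental.finite_deRhamCohomology_of_compactSpace`, `Literature.NumberTheory.Transcendental.finrank_deRhamCohomology_eq_bettiNumber`,
  `Literature.NumberTheory.Transcendental.finrank_complexDeRham_eq_bettiNumber`: finiteness and Betti numbers of compact manifolds.
* `Literature.Geometry.Kaehler.deRhamCohomology.map_eq_of_homotopic`: smooth homotopy invariance (Bott–Tu (1982),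
  Cor. 4.1.2; Warner (1983), 4.19).

Each keeps its theorem name and its full hypotheses (`[FiniteDimensional ℝ E]`,
`[FiniteDimensional ℂ E]`, `[CompleteSpace F]` are binders of the definition, so the fact is
exactly as strong as the cited source); consumers take `(h : Literature.exists_deRhamIsoFamily I)` etc.
as an explicit hypothesis. The pull-back / wedge calculus of `FormsAlgebra` enters through the
instance hypotheses `[Literature.PullbackFacts …]` / `[Literature.WedgeFacts …]` (D-0014 there), which are
therefore quantified in `DeRhamIsoFamily.IsNatural` / `.IsMultiplicative` and assumed by the
complex pull-back API.

## Mathlib status (pinned v4.32.0)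

Mathlib has neither de Rham cohomology of manifolds nor singular cohomology nor any comparison
between them (searched: `deRham`, `de_rham`, `singularCohomology`, `DeRham`); both sides are H21
preludes. From Mathlib we use `ContMDiff`, products of models with corners
(`ModelWithCorners.prod`, for smooth homotopies `ℝ × M → N`), `Module.finrank`, `Module.Finite`,
`Submodule.mapQ`, `Submodule.map_span_le`, `fderivWithin_const_apply` and
`ContinuousAlternatingMap.alternatizeUncurryFinCLM` (for `d(const) = 0`).

## Design notes

* The facts `exists_deRhamIsoFamily` etc. assume `[FiniteDimensional ℝ E]`: smooth partitions
  of unity (`SmoothPartitionOfUnity.exists_isSubordinate`) and the sheaf-theoretic proof need it,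
  and for Banach manifolds the statement is false in general. No `I.Boundaryless` is assumed:
  `range I` is convex (`ModelWithCorners.convex_range`), so the Poincaré lemma holds in charts and
  de Rham's theorem holds verbatim for manifolds with boundary and corners.
* Smooth homotopies are maps `ℝ × M → N` that are `C^∞` for `𝓘(ℝ, ℝ).prod I` (Bott–Tu's
  convention, §I.4), avoiding manifolds with boundary `[0,1] × M`. Homotopy invariance is stated
  for complete coefficient spaces `F` only (it implies the Poincaré lemma, false for `F = c₀₀`).
* `finite_deRhamCohomology_of_compactSpace` is metric-free and supersedes, for consumers without
  a Riemannian metric, the accepted metric-dependent `Literature.AlgebraicGeometry.Motives.finite_deRhamCohomology`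
  (`H21/Statements/Hodge/HodgeTheorem.lean:110`, via harmonic forms).
* G04's `bettiNumber R X k` is `finrank R Hₖ(X; R)` of singular *homology*; over a field
  `Hᵏ(X; K) ≅ Hom_K(Hₖ(X; K), K)` (universal coefficients), so for compact `M` (finite Betti
  numbers) `finrank Hᵏ = finrank Hₖ` and the equalities `finrank H^k_dR = bettiNumber` below are
  the intended ones.
* An `IsIntegral` compatibility (top-degree class paired with a fundamental class equals
  `deRhamCohomology.integral`) is omitted in v0: it needs a bridge from pointwise orientations to
  G04's `HomologicalOrientation`, which no accepted file provides (outline §4).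

## References

* G. de Rham, *Sur l'analysis situs des variétés à n dimensions*, J. Math. Pures Appl. 10 (1931).
* F. W. Warner, *Foundations of Differentiable Manifolds and Lie Groups* (1983), 4.19, 5.28–5.45.
* R. Bott, L. W. Tu, *Differential Forms in Algebraic Topology* (1982), §I.4–I.5, §8, §15.
* A. Hatcher, *Algebraic Topology* (2002), §3.1 (universal coefficients), Cor. A.8–A.9.
-/

noncomputable section

open scoped Manifold ContDiff Topology
open Set

universe u

namespace Literature.NumberTheory.Transcendental

/-! ### The constant `0`-form and the unit of de Rham cohomology -/

section Const

variable {E : Type*} [NormedAddCommGroup E] [NormedSpace ℝ E]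
  {H : Type*} [TopologicalSpace H] {I : ModelWithCorners ℝ E H}
  {M : Type*} [TopologicalSpace M] [ChartedSpace H M]
  {F : Type*} [NormedAddCommGroup F] [NormedSpace ℝ F]
  {A : Type*} [NormedCommRing A] [NormedAlgebra ℝ A]

section MForm
open Literature.Geometry.Kaehler (MForm)
open Literature.Geometry.Kaehler.MForm

variable (I M) in
/-- The constant `0`-form on `M` with value `a : F`, i.e. the constant function `a` viewed as a
differential form of degree `0` (Warner (1983), 2.15: `E⁰(M) = C^∞(M)`); built from Mathlib's
`ContinuousAlternatingMap.constOfIsEmpty`. [cite: WarnerGTM94, 2.15] -/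
def _root_.Literature.Geometry.Kaehler.MForm.const (a : F) : MForm I M F 0 := fun _ ↦
  ContinuousAlternatingMap.constOfIsEmpty ℝ E (Fin 0) a

/-- Evaluation of the constant `0`-form (definitional). [folklore] -/
@[simp]
theorem _root_.Literature.Geometry.Kaehler.MForm.const_apply (a : F) (x : M) (v : Fin 0 → TangentSpace I x) : const I M a x v = a :=
  rfl

/-- The chart representative of a constant `0`-form is the constant `0`-form on the model space
(Warner (1983), §2.18). [cite: WarnerGTM94, §2.18] -/
theorem _root_.Literature.Geometry.Kaehler.MForm.inChart_const (a : F) (x₀ : M) :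
    (const I M a).inChart x₀ = fun _ ↦ ContinuousAlternatingMap.constOfIsEmpty ℝ E (Fin 0) a := by
  funext y
  ext v
  rfl

end MForm

/-- Constant `0`-forms are smooth (Warner (1983), 2.15). [cite: WarnerGTM94, 2.15] -/
theorem isSmoothForm_const (a : F) : Literature.Geometry.Kaehler.IsSmoothForm (Literature.Geometry.Kaehler.MForm.const I M a) := fun x ↦ by
  rw [Literature.Geometry.Kaehler.MForm.inChart_const]
  exact contDiffWithinAt_const

/-- Constant `0`-forms are closed: `d(a) = 0` (Warner (1983), 2.20; in charts this is Mathlib's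
`fderivWithin_const_apply`). [cite: WarnerGTM94, 2.20] -/
theorem mextDeriv_const (a : F) : Literature.Geometry.Kaehler.mextDeriv (Literature.Geometry.Kaehler.MForm.const I M a) = 0 := by
  funext x
  have h : extDerivWithin (fun _ : E ↦ ContinuousAlternatingMap.constOfIsEmpty ℝ E (Fin 0) a)
      (range I) (extChartAt I x x) = 0 := by
    rw [extDerivWithin, fderivWithin_const_apply,
      ← ContinuousAlternatingMap.alternatizeUncurryFinCLM_apply, map_zero]
  simp only [Literature.Geometry.Kaehler.mextDeriv, Literature.Geometry.Kaehler.MForm.inChart_const, h]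
  ext v
  rfl

/-- Constant `0`-forms are closed smooth forms (Warner (1983), 4.11: `H⁰_dR` contains the
constants). [cite: WarnerGTM94, 4.11] -/
theorem const_mem_closedSmoothForms (a : F) : Literature.Geometry.Kaehler.MForm.const I M a ∈ Literature.Geometry.Kaehler.closedSmoothForms I M F 0 :=
  ⟨isSmoothForm_const a, mextDeriv_const a⟩

variable (I M A) in
/-- The unit `1 = [1] ∈ H⁰_dR(M; A)` of the de Rham cohomology ring: the class of the constant
`0`-form `1` (Bott–Tu (1982), §I.1; Warner (1983), 4.11). [cite: BottTu1982Forms, §I.1] -/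
def _root_.Literature.Geometry.Kaehler.deRhamCohomology.one : Literature.Geometry.Kaehler.deRhamCohomology I M A 0 :=
  Literature.Geometry.Kaehler.deRhamCohomology.mk ⟨Literature.Geometry.Kaehler.MForm.const I M (1 : A), const_mem_closedSmoothForms 1⟩

/-- Pull-back preserves constant `0`-forms: `f^* a = a` (Warner (1983), 2.22). [cite: WarnerGTM94, 2.22] -/
@[simp]
theorem _root_.Literature.Geometry.Kaehler.MForm.pullback_const {E' : Type*} [NormedAddCommGroup E'] [NormedSpace ℝ E']
    {H' : Type*} [TopologicalSpace H'] {I' : ModelWithCorners ℝ E' H'}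
    {N : Type*} [TopologicalSpace N] [ChartedSpace H' N] (f : M → N) (a : F) :
    (Literature.Geometry.Kaehler.MForm.const I' N a).pullback I f = Literature.Geometry.Kaehler.MForm.const I M a := by
  funext x
  ext v
  rfl

end Const

/-! ### Smooth homotopy invariance of de Rham cohomology -/

section Homotopy

variable {E : Type*} [NormedAddCommGroup E] [NormedSpace ℝ E]
  {H : Type*} [TopologicalSpace H] {I : ModelWithCorners ℝ E H}
  {M : Type*} [TopologicalSpace M] [ChartedSpace H M] [IsManifold I ∞ M]
  {E' : Type*} [NormedAddCommGroup E'] [NormedSpace ℝ E']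
  {H' : Type*} [TopologicalSpace H'] {I' : ModelWithCorners ℝ E' H'}
  {N : Type*} [TopologicalSpace N] [ChartedSpace H' N] [IsManifold I' ∞ N]
  {F : Type*} [NormedAddCommGroup F] [NormedSpace ℝ F]

variable (I M I' N F) in
/-- **Smooth homotopy invariance** of de Rham cohomology: if `f, g : M → N` are `C^∞` and joined
by a smooth homotopy `Φ : ℝ × M → N` (`C^∞` for the product model `𝓘(ℝ, ℝ).prod I`, with
`Φ(0, ·) = f` and `Φ(1, ·) = g`), then `f^* = g^*` on `H^k_dR(N; F)`.
The coefficient space `F` must be complete (the binder `[CompleteSpace F]` is part of the fact):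
the homotopy operator integrates `F`-valued forms along `[0, 1]`, and homotopy invariance implies
the Poincaré lemma, which fails for e.g. `F = c₀₀` (cf.
`ExactSmoothFormsEqClosedSmoothFormsOfConvex` in `FormsAlgebra`). The smoothness hypotheses `hf`, `hg` follow from `hΦ`, `h₀`, `h₁`; they are
carried only to form `deRhamCohomology.map hf` / `map hg` (which rely on the pull-back calculus
`[PullbackFacts I M I' N F]`).
Bott–Tu (1982), Cor. 4.1.2 (homotopy `M × ℝ → N`); Warner (1983), 4.19 (via the homotopy
operator); both for `F = ℝ`, the Banach-valued case is verbatim. Named fact (D-0014). [cite: BottTu1982Forms, Cor. 4.1.2] -/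
def _root_.Literature.Geometry.Kaehler.deRhamCohomology.map_eq_of_homotopic [CompleteSpace F] [PullbackFacts I M I' N F] : Prop :=
  ∀ {f g : M → N} (hf : ContMDiff I I' ∞ f) (hg : ContMDiff I I' ∞ g) (Φ : ℝ × M → N),
    ContMDiff (𝓘(ℝ, ℝ).prod I) I' ∞ Φ → (∀ x, Φ (0, x) = f x) → (∀ x, Φ (1, x) = g x) →
    ∀ k : ℕ,
    (Literature.Geometry.Kaehler.deRhamCohomology.map hf k : Literature.Geometry.Kaehler.deRhamCohomology I' N F k →ₗ[ℝ] Literature.Geometry.Kaehler.deRhamCohomology I M F k) =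
      Literature.Geometry.Kaehler.deRhamCohomology.map hg k

end Homotopy

/-! ### The de Rham isomorphism family (real coefficients) -/

section Family

variable {E : Type u} [NormedAddCommGroup E] [NormedSpace ℝ E]
  {H : Type u} [TopologicalSpace H] (I : ModelWithCorners ℝ E H)

/-- A **de Rham isomorphism family** for the model with corners `I`: for every `C^∞`, Hausdorff,
σ-compact manifold `M : Type u` modelled on `I` and every degree `k`, an `ℝ`-linear isomorphism
`e M k : H^k_dR(M; ℝ) ≃ₗ[ℝ] H^k(M; ℝ)` between G21's de Rham cohomology and G04's singular
cohomology with real coefficients. de Rham's theorem (`exists_deRhamIsoFamily`) asserts the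
existence of such a family that is natural, multiplicative and normalised; see the module
docstring for why the family (rather than `Nonempty (_ ≃ₗ[ℝ] _)`) is the right currency.
de Rham (1931); Warner (1983), 5.36; Bott–Tu (1982), Thm. 8.9. [cite: deRham1931] -/
def DeRhamIsoFamily : Type (u + 1) :=
  ∀ (M : Type u) [TopologicalSpace M] [ChartedSpace H M] [IsManifold I ∞ M] [T2Space M]
    [SigmaCompactSpace M] (k : ℕ),
    Literature.Geometry.Kaehler.deRhamCohomology I M ℝ k ≃ₗ[ℝ] Literature.AlgebraicTopology.SingularHomology.singularCohomology ℝ ℝ M k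

namespace DeRhamIsoFamily

variable {I}

/-- **Naturality** of a de Rham isomorphism family: for every `C^∞` map `f : M → N` of manifolds
modelled on `I`, the square with the pull-backs `f^*` on de Rham cohomology
(`deRhamCohomology.map`, under the pull-back calculus `[PullbackFacts I M I N ℝ]` of
`FormsAlgebra`) and on singular cohomology (`singularCohomology.map`) commutes,
`e_M (f^* c) = f^* (e_N c)`. Warner (1983), 5.36–5.38; Bott–Tu (1982), §I.5. [cite: WarnerGTM94, 5.36–5.38] -/
def IsNatural (e : DeRhamIsoFamily I) : Prop :=
  ∀ (M N : Type u) [TopologicalSpace M] [ChartedSpace H M] [IsManifold I ∞ M] [T2Space M]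
    [SigmaCompactSpace M] [TopologicalSpace N] [ChartedSpace H N] [IsManifold I ∞ N] [T2Space N]
    [SigmaCompactSpace N] [PullbackFacts I M I N ℝ] (f : M → N) (hf : ContMDiff I I ∞ f) (k : ℕ)
    (c : Literature.Geometry.Kaehler.deRhamCohomology I N ℝ k),
    e M k (Literature.Geometry.Kaehler.deRhamCohomology.map hf k c) =
      Literature.AlgebraicTopology.SingularHomology.singularCohomology.map ℝ ℝ ⟨f, hf.continuous⟩ k (e N k c)

/-- **Multiplicativity** of a de Rham isomorphism family: it carries the cup product induced by
the wedge product (`deRhamCohomology.cup`, `[α] ⌣ [β] = [α ∧ β]`, under the wedge calculus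
`[WedgeFacts I M ℝ]` of `FormsAlgebra`) to the Alexander–Whitney cup product on singular
cohomology (`cupProduct`): `e (a ⌣ b) = e a ⌣ e b`.
Warner (1983), Thm. 5.45; Bott–Tu (1982), Thm. 14.28 / 15.8. [cite: WarnerGTM94, Thm. 5.45] -/
def IsMultiplicative (e : DeRhamIsoFamily I) : Prop :=
  ∀ (M : Type u) [TopologicalSpace M] [ChartedSpace H M] [IsManifold I ∞ M] [T2Space M]
    [SigmaCompactSpace M] [WedgeFacts I M ℝ] (k l m : ℕ) (h : k + l = m)
    (a : Literature.Geometry.Kaehler.deRhamCohomology I M ℝ k) (b : Literature.Geometry.Kaehler.deRhamCohomology I M ℝ l),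
    e M m (Literature.Geometry.Kaehler.deRhamCohomology.cup h a b) = Literature.AlgebraicTopology.SingularHomology.cupProduct h (e M k a) (e M l b)

/-- **Normalisation** of a de Rham isomorphism family in degree `0`: the class of the constant
function `1` goes to the unit `1 ∈ H⁰(M; ℝ)` (`singularCohomology.one`, the class of the cochain
that is `1` on every singular `0`-simplex). Together with naturality this pins down the sign
conventions. Warner (1983), 5.36 / 5.45; Bott–Tu (1982), §I.5. [cite: WarnerGTM94, 5.36 / 5.45] -/
def IsNormalized (e : DeRhamIsoFamily I) : Prop :=
  ∀ (M : Type u) [TopologicalSpace M] [ChartedSpace H M] [IsManifold I ∞ M] [T2Space M]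
    [SigmaCompactSpace M],
    e M 0 (Literature.Geometry.Kaehler.deRhamCohomology.one I M ℝ) = Literature.AlgebraicTopology.SingularHomology.singularCohomology.one ℝ M

/-- The naturality square for the identity map commutes for *every* family (sanity check that
the two functorialities `deRhamCohomology.map_id` and `singularCohomology.map_id` line up;
Warner (1983), 5.38). [cite: WarnerGTM94, 5.38] -/
theorem apply_map_id (e : DeRhamIsoFamily I) (M : Type u)
    [TopologicalSpace M] [ChartedSpace H M] [IsManifold I ∞ M] [T2Space M] [SigmaCompactSpace M]
    [PullbackFacts I M I M ℝ] (k : ℕ) (c : Literature.Geometry.Kaehler.deRhamCohomology I M ℝ k) :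
    e M k (Literature.Geometry.Kaehler.deRhamCohomology.map (contMDiff_id : ContMDiff I I ∞ (id : M → M)) k c) =
      Literature.AlgebraicTopology.SingularHomology.singularCohomology.map ℝ ℝ (ContinuousMap.id M) k (e M k c) := by
  rw [Literature.Geometry.Kaehler.deRhamCohomology.map_id, Literature.AlgebraicTopology.SingularHomology.singularCohomology.map_id]
  rfl

/-- A multiplicative and normalised family sends `[1] ⌣ a` to `e a` (from `one_cupProduct`;
Bott–Tu (1982), §I.5). [cite: BottTu1982Forms, §I.5] -/
theorem IsMultiplicative.map_cup_one {e : DeRhamIsoFamily I} (he : e.IsMultiplicative)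
    (he₁ : e.IsNormalized) (M : Type u) [TopologicalSpace M] [ChartedSpace H M]
    [IsManifold I ∞ M] [T2Space M] [SigmaCompactSpace M] [WedgeFacts I M ℝ] (l : ℕ)
    (b : Literature.Geometry.Kaehler.deRhamCohomology I M ℝ l) :
    e M l (Literature.Geometry.Kaehler.deRhamCohomology.cup (Nat.zero_add l) (Literature.Geometry.Kaehler.deRhamCohomology.one I M ℝ) b) = e M l b := by
  rw [he, he₁, Literature.AlgebraicTopology.SingularHomology.one_cupProduct]

end DeRhamIsoFamily

/-- **de Rham's theorem.** For a finite-dimensional model with corners `I` there is a de Rham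
isomorphism family `H^k_dR(M; ℝ) ≃ₗ[ℝ] H^k(M; ℝ)` over all `C^∞`, Hausdorff, σ-compact
manifolds `M` modelled on `I`, which is natural for `C^∞` maps, multiplicative (wedge ↦ cup) and
normalised (`[1] ↦ 1`). de Rham (1931); Warner (1983), Thm. 5.36 (isomorphism, via sheaf
cohomology of the fine resolution `ℝ → Ω⁰ → Ω¹ → ⋯`) and Thm. 5.45 (multiplicativity);
Bott–Tu (1982), Thm. 8.9 and Thm. 15.8; the integration map `α ↦ (σ ↦ ∫_σ α)` over smooth
singular simplices realises it (Warner 4.17, 5.44). Manifolds with boundary or corners are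
included (`range I` is convex, so the Poincaré lemma holds in charts). The model space must be
finite-dimensional (the binder `[FiniteDimensional ℝ E]` is part of the fact; for Banach
manifolds the statement is false in general). Named fact (D-0014); consumers take
`(h : exists_deRhamIsoFamily I)`. [cite: WarnerGTM94, Thm. 5.36 / Thm. 5.45] -/
def exists_deRhamIsoFamily [FiniteDimensional ℝ E] : Prop :=
  ∃ e : DeRhamIsoFamily I, e.IsNatural ∧ e.IsMultiplicative ∧ e.IsNormalized

end Family

/-! ### Corollaries for compact manifolds (real coefficients) -/

section Compact

variable {E : Type*} [NormedAddCommGroup E] [NormedSpace ℝ E]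
  {H : Type*} [TopologicalSpace H] (I : ModelWithCorners ℝ E H)

/-- **Finite-dimensionality of de Rham cohomology of compact manifolds** (metric-free): for a
compact `C^∞` Hausdorff manifold `M` (possibly with boundary or corners) on a finite-dimensional
model (the binder `[FiniteDimensional ℝ E]` is part of the fact), `H^k_dR(M; ℝ)` is a
finite-dimensional real vector space. Consequence of de Rham's theorem and the finiteness of the
singular cohomology of a compact manifold (Hatcher (2002), Cor. A.8–A.9 with §3.1), or directly
by a good-cover Mayer–Vietoris argument (Bott–Tu (1982), Prop. 5.3.1). This supersedes, for
consumers without a Riemannian metric, the accepted metric-dependent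
`Literature.AlgebraicGeometry.Motives.finite_deRhamCohomology` (`H21/Statements/Hodge/HodgeTheorem.lean:110`, finiteness
via harmonic representatives, Warner (1983), 6.11). Named fact (D-0014), one `Prop` per
manifold and degree (so that the universe of `M` is free); consumers take
`(h : finite_deRhamCohomology_of_compactSpace I M k)`. [cite: HatcherAT2002, Cor. A.8–A.9] -/
def finite_deRhamCohomology_of_compactSpace [FiniteDimensional ℝ E] (M : Type*)
    [TopologicalSpace M] [ChartedSpace H M] [IsManifold I ∞ M] [T2Space M] [CompactSpace M]
    (k : ℕ) : Prop :=
  Module.Finite ℝ (Literature.Geometry.Kaehler.deRhamCohomology I M ℝ k)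

/-- **de Rham cohomology computes Betti numbers**: for a compact `C^∞` Hausdorff manifold `M`
on a finite-dimensional model (the binder `[FiniteDimensional ℝ E]` is part of the fact),
`dim_ℝ H^k_dR(M; ℝ) = b_k(M; ℝ)`. Here G04's `bettiNumber ℝ M k` is
`finrank ℝ Hₖ(M; ℝ)`, the rank of singular *homology*; since over a field
`Hᵏ(M; ℝ) ≅ Hom_ℝ(Hₖ(M; ℝ), ℝ)` (universal coefficient theorem, Hatcher (2002), Thm. 3.2) and
`Hₖ(M; ℝ)` is finite-dimensional for compact `M` (Hatcher, Cor. A.8–A.9), the cohomological and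
homological ranks agree, and the equality is de Rham's theorem (`exists_deRhamIsoFamily`)
followed by universal coefficients. de Rham (1931); Bott–Tu (1982), §I.5. Named fact (D-0014),
one `Prop` per manifold and degree; consumers take
`(h : finrank_deRhamCohomology_eq_bettiNumber I M k)`. [cite: HatcherAT2002, Thm. 3.2 / Cor. A.8–A.9] -/
def finrank_deRhamCohomology_eq_bettiNumber [FiniteDimensional ℝ E] (M : Type*)
    [TopologicalSpace M] [ChartedSpace H M] [IsManifold I ∞ M] [T2Space M] [CompactSpace M]
    (k : ℕ) : Prop :=
  Module.finrank ℝ (Literature.Geometry.Kaehler.deRhamCohomology I M ℝ k) = Literature.AlgebraicTopology.SingularHomology.bettiNumber ℝ M k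

end Compact

/-! ### Complex coefficients: pull-back on `H^k_dR(M; ℂ)` -/

section ComplexMap

variable {E : Type*} [NormedAddCommGroup E] [NormedSpace ℂ E]
  {M : Type*} [TopologicalSpace M] [ChartedSpace E M]
  {E' : Type*} [NormedAddCommGroup E'] [NormedSpace ℂ E']
  {N : Type*} [TopologicalSpace N] [ChartedSpace E' N] {k : ℕ}

variable (E) in
/-- The `ℂ`-linear pull-back `β ↦ f^* β` on complex-valued forms along a map `f : M → N` of
manifolds modelled on complex normed spaces (the `ℂ`-linear upgrade of C6's `ℝ`-linear
`MForm.pullbackₗ`; `ℂ`-linearity, i.e. `f^*(c • β) = c • f^* β` for the `ℂ`-action on values,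
holds definitionally). Warner (1983), 2.22; Wells (1980), Ch. II §1. [cite: WarnerGTM94, 2.22] -/
def _root_.Literature.Geometry.Kaehler.MForm.cpullbackₗ (f : M → N) (k : ℕ) : Literature.Geometry.Kaehler.MForm 𝓘(ℝ, E') N ℂ k →ₗ[ℂ] Literature.Geometry.Kaehler.MForm 𝓘(ℝ, E) M ℂ k where
  toFun β := β.pullback 𝓘(ℝ, E) f
  map_add' _ _ := rfl
  map_smul' _ _ := rfl

/-- `cpullbackₗ E f k β = β.pullback 𝓘(ℝ, E) f` (definitional). [folklore] -/
@[simp]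
theorem _root_.Literature.Geometry.Kaehler.MForm.cpullbackₗ_apply (f : M → N) (β : Literature.Geometry.Kaehler.MForm 𝓘(ℝ, E') N ℂ k) :
    Literature.Geometry.Kaehler.MForm.cpullbackₗ E f k β = β.pullback 𝓘(ℝ, E) f :=
  rfl

variable [IsManifold 𝓘(ℝ, E) ∞ M] [IsManifold 𝓘(ℝ, E') ∞ N] [PullbackFacts 𝓘(ℝ, E) M 𝓘(ℝ, E') N ℂ]

/-- Pull-back along a `C^∞` map preserves the `ℂ`-module of smooth complex forms
(Warner (1983), 2.22–2.23; from C6's `isSmoothForm_pullback`, via the pull-back calculus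
`[PullbackFacts 𝓘(ℝ, E) M 𝓘(ℝ, E') N ℂ]`). [cite: WarnerGTM94, 2.22–2.23] -/
theorem pullback_mem_csmoothForms {f : M → N} (hf : ContMDiff 𝓘(ℝ, E) 𝓘(ℝ, E') ∞ f)
    {β : Literature.Geometry.Kaehler.MForm 𝓘(ℝ, E') N ℂ k} (hβ : β ∈ csmoothForms E' N k) :
    β.pullback 𝓘(ℝ, E) f ∈ csmoothForms E M k := by
  rw [mem_csmoothForms_iff] at hβ ⊢
  exact isSmoothForm_pullback hf hβ

/-- Pull-back along a `C^∞` map preserves the `ℂ`-module of closed smooth complex forms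
(Bott–Tu (1982), §I.2; from C6's `pullback_mem_closedSmoothForms` and `Submodule.map_span_le`). [cite: BottTu1982Forms, §I.2] -/
theorem pullback_mem_cclosedSmoothForms {f : M → N} (hf : ContMDiff 𝓘(ℝ, E) 𝓘(ℝ, E') ∞ f)
    {β : Literature.Geometry.Kaehler.MForm 𝓘(ℝ, E') N ℂ k} (hβ : β ∈ cclosedSmoothForms E' N k) :
    β.pullback 𝓘(ℝ, E) f ∈ cclosedSmoothForms E M k := by
  have h : (cclosedSmoothForms E' N k).map (Literature.Geometry.Kaehler.MForm.cpullbackₗ E f k) ≤ cclosedSmoothForms E M k :=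
    (Submodule.map_span_le _ _ _).2 fun γ hγ ↦
      Submodule.subset_span (pullback_mem_closedSmoothForms hf hγ)
  exact h (Submodule.mem_map_of_mem hβ)

/-- Pull-back along a `C^∞` map preserves the `ℂ`-module of exact smooth complex forms:
`f^*(dγ) = d(f^*γ)` (Bott–Tu (1982), §I.2; from C6's `mextDeriv_pullback`). [cite: BottTu1982Forms, §I.2] -/
theorem pullback_mem_cexactSmoothForms {f : M → N} (hf : ContMDiff 𝓘(ℝ, E) 𝓘(ℝ, E') ∞ f)
    {β : Literature.Geometry.Kaehler.MForm 𝓘(ℝ, E') N ℂ k} (hβ : β ∈ cexactSmoothForms E' N k) :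
    β.pullback 𝓘(ℝ, E) f ∈ cexactSmoothForms E M k := by
  cases k with
  | zero =>
    have h0 : β = 0 := (Submodule.mem_bot ℂ).1 hβ
    subst h0
    exact Submodule.zero_mem _
  | succ k =>
    have h : (cexactSmoothForms E' N (k + 1)).map (Literature.Geometry.Kaehler.MForm.cpullbackₗ E f (k + 1)) ≤
        cexactSmoothForms E M (k + 1) := by
      refine (Submodule.map_span_le _ _ _).2 ?_
      rintro _ ⟨γ, hγ, rfl⟩
      have hγs : Literature.Geometry.Kaehler.IsSmoothForm γ := (mem_csmoothForms_iff γ).1 hγ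
      refine Submodule.subset_span ⟨γ.pullback 𝓘(ℝ, E) f, ?_, ?_⟩
      · exact (mem_csmoothForms_iff _).2 (isSmoothForm_pullback hf hγs)
      · exact mextDeriv_pullback hf hγs
    exact h (Submodule.mem_map_of_mem hβ)

variable (E) in
/-- The `ℂ`-linear map `f^* : H^k_dR(N; ℂ) → H^k_dR(M; ℂ)` induced on complex de Rham cohomology
by a `C^∞` map `f : M → N` (pull-back of representatives, via `Submodule.mapQ`; the complex
analogue of C6's `deRhamCohomology.map`). Bott–Tu (1982), §I.2; Wells (1980), Ch. II §1.
Relies on: the named facts `IsSmoothFormPullback`, `MextDerivPullback` (via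
`[PullbackFacts 𝓘(ℝ, E) M 𝓘(ℝ, E') N ℂ]`, through `pullback_mem_cclosedSmoothForms`,
`pullback_mem_cexactSmoothForms`). [cite: BottTu1982Forms, §I.2] -/
def complexDeRhamCohomology.map {f : M → N} (hf : ContMDiff 𝓘(ℝ, E) 𝓘(ℝ, E') ∞ f) (k : ℕ) :
    complexDeRhamCohomology E' N k →ₗ[ℂ] complexDeRhamCohomology E M k :=
  Submodule.mapQ _ _
    ((Literature.Geometry.Kaehler.MForm.cpullbackₗ E f k).restrict fun _ hβ ↦ pullback_mem_cclosedSmoothForms hf hβ)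
    fun _ hβ ↦ pullback_mem_cexactSmoothForms hf hβ

/-- `f^*` on the class of a closed complex form is the class of the pulled-back form
(definitional; Bott–Tu (1982), §I.2). [cite: BottTu1982Forms, §I.2] -/
theorem complexDeRhamCohomology.map_mk {f : M → N} (hf : ContMDiff 𝓘(ℝ, E) 𝓘(ℝ, E') ∞ f)
    (β : cclosedSmoothForms E' N k) :
    complexDeRhamCohomology.map E hf k (complexDeRhamCohomology.mk E' N k β) =
      complexDeRhamCohomology.mk E M k
        ⟨(β : Literature.Geometry.Kaehler.MForm 𝓘(ℝ, E') N ℂ k).pullback 𝓘(ℝ, E) f, pullback_mem_cclosedSmoothForms hf β.2⟩ :=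
  rfl

/-- Functoriality: the identity induces the identity on complex de Rham cohomology
(Bott–Tu (1982), §I.2). [cite: BottTu1982Forms, §I.2] -/
theorem complexDeRhamCohomology.map_id [PullbackFacts 𝓘(ℝ, E) M 𝓘(ℝ, E) M ℂ] (k : ℕ) :
    complexDeRhamCohomology.map E (contMDiff_id : ContMDiff 𝓘(ℝ, E) 𝓘(ℝ, E) ∞ (id : M → M)) k =
      LinearMap.id := by
  refine Submodule.linearMap_qext _ (LinearMap.ext fun β ↦ ?_)
  change complexDeRhamCohomology.map E contMDiff_id k (complexDeRhamCohomology.mk E M k β) =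
    complexDeRhamCohomology.mk E M k β
  rw [complexDeRhamCohomology.map_mk]
  congr 1
  exact Subtype.ext (Literature.Geometry.Kaehler.MForm.pullback_id _)

end ComplexMap

/-! ### The de Rham isomorphism family (complex coefficients) -/

section ComplexFamily

variable (E : Type u) [NormedAddCommGroup E] [NormedSpace ℂ E]

/-- A **complex de Rham isomorphism family** for the complex model space `E`: for every real
`C^∞`, Hausdorff, σ-compact manifold `M : Type u` charted on `E` and every degree `k`, a
`ℂ`-linear isomorphism `e M k : H^k_dR(M; ℂ) ≃ₗ[ℂ] H^k(M; ℂ)` between C9's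
`complexDeRhamCohomology E M k` and G04's singular cohomology with complex coefficients.
(Only the real-smooth structure `𝓘(ℝ, E)` is required; complex manifolds
`[IsManifold 𝓘(ℂ, E) ω M]` are the intended consumers.) de Rham (1931) ⊗ ℂ; Weil (1952);
Voisin (2002), §6.1; Wells (1980), Thm. II.3.14 / III.4.13. [cite: deRham1931] -/
def ComplexDeRhamIsoFamily : Type (u + 1) :=
  ∀ (M : Type u) [TopologicalSpace M] [ChartedSpace E M] [IsManifold 𝓘(ℝ, E) ∞ M] [T2Space M]
    [SigmaCompactSpace M] (k : ℕ),
    complexDeRhamCohomology E M k ≃ₗ[ℂ] Literature.AlgebraicTopology.SingularHomology.singularCohomology ℂ ℂ M k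

namespace ComplexDeRhamIsoFamily

variable {E}

/-- **Naturality** of a complex de Rham isomorphism family: for every `C^∞` map `f : M → N` of
manifolds charted on `E`, `e_M (f^* c) = f^* (e_N c)` with `complexDeRhamCohomology.map` on the
left (under the pull-back calculus `[PullbackFacts 𝓘(ℝ, E) M 𝓘(ℝ, E) N ℂ]` of `FormsAlgebra`)
and `singularCohomology.map ℂ ℂ` on the right. Bott–Tu (1982), §I.5; Wells (1980),
Ch. II §3. [cite: BottTu1982Forms, §I.5] -/
def IsNatural (e : ComplexDeRhamIsoFamily E) : Prop :=
  ∀ (M N : Type u) [TopologicalSpace M] [ChartedSpace E M] [IsManifold 𝓘(ℝ, E) ∞ M] [T2Space M]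
    [SigmaCompactSpace M] [TopologicalSpace N] [ChartedSpace E N] [IsManifold 𝓘(ℝ, E) ∞ N]
    [T2Space N] [SigmaCompactSpace N] [PullbackFacts 𝓘(ℝ, E) M 𝓘(ℝ, E) N ℂ] (f : M → N)
    (hf : ContMDiff 𝓘(ℝ, E) 𝓘(ℝ, E) ∞ f) (k : ℕ) (c : complexDeRhamCohomology E N k),
    e M k (complexDeRhamCohomology.map E hf k c) =
      Literature.AlgebraicTopology.SingularHomology.singularCohomology.map ℂ ℂ ⟨f, hf.continuous⟩ k (e N k c)

end ComplexDeRhamIsoFamily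

/-- **de Rham's theorem with complex coefficients.** For a finite-dimensional complex normed
space `E` (the binder `[FiniteDimensional ℂ E]` is part of the fact) there is a natural family
of `ℂ`-linear isomorphisms `H^k_dR(M; ℂ) ≃ₗ[ℂ] H^k(M; ℂ)` over all real-`C^∞`, Hausdorff,
σ-compact manifolds charted on `E`. Obtained from the real de Rham theorem by `⊗_ℝ ℂ` on both
sides (`H^k_dR(M; ℂ) = H^k_dR(M; ℝ) ⊗ ℂ` since `d` is `ℂ`-linear on `ℂ`-valued forms;
`H^k(M; ℂ) = H^k(M; ℝ) ⊗ ℂ` by universal coefficients).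
de Rham (1931); Weil (1952); Wells (1980), Thm. III.4.13; Voisin (2002), §6.1.1. Named fact
(D-0014); consumers take `(h : exists_complexDeRhamIsoFamily E)`. [cite: WellsDACM1980, Thm. III.4.13] -/
def exists_complexDeRhamIsoFamily [FiniteDimensional ℂ E] : Prop :=
  ∃ e : ComplexDeRhamIsoFamily E, e.IsNatural

/-- **Complex de Rham cohomology computes Betti numbers**: for a compact real-`C^∞` Hausdorff
manifold `M` charted on the finite-dimensional complex normed space `E` (the binder
`[FiniteDimensional ℂ E]` is part of the fact), `dim_ℂ H^k_dR(M; ℂ) = b_k(M; ℂ)`. As for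
`finrank_deRhamCohomology_eq_bettiNumber`, G04's `bettiNumber ℂ M k = finrank ℂ Hₖ(M; ℂ)` is a
*homological* rank, equal to `finrank ℂ Hᵏ(M; ℂ)` by universal coefficients over the field `ℂ`
and finiteness for compact `M` (Hatcher (2002), Thm. 3.2, Cor. A.8–A.9); the equality is then
`exists_complexDeRhamIsoFamily`. (Also `b_k(M; ℂ) = b_k(M; ℝ)`.) Voisin (2002), §6.1;
Wells (1980), Ch. II §3. Named fact (D-0014), one `Prop` per manifold and degree (so that the
universe of `M` is free); consumers take `(h : finrank_complexDeRham_eq_bettiNumber E M k)`. [cite: HatcherAT2002, Thm. 3.2 / Cor. A.8–A.9] -/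
def finrank_complexDeRham_eq_bettiNumber [FiniteDimensional ℂ E] (M : Type*)
    [TopologicalSpace M] [ChartedSpace E M] [IsManifold 𝓘(ℝ, E) ∞ M] [T2Space M]
    [CompactSpace M] (k : ℕ) : Prop :=
  Module.finrank ℂ (complexDeRhamCohomology E M k) = Literature.AlgebraicTopology.SingularHomology.bettiNumber ℂ M k

end ComplexFamily

end Literature.NumberTheory.Transcendental
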